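import Mathlib
import Summits.ValiantsHypothesis.ValiantsHypothesis.Theorems.LacunarySymmetroidMatrixDescartesMonotoneExactPencil

/-!
# `MatrixDescartes` (stmt-ValiantsHypothesis-18050) — THE THREE-LETTER FORMULA: for the smallest two-sided format
# `X^a S₋ + X^b S₀ + X^c S₊` (`a < b < c`, `det S₀ ≠ 0`, `S₊ ⪰ 0`, `S₋ ⪯ 0`) the positive zeros counted with multiplicity
# number EXACTLY `ν(S₊S₀⁻¹S₊) + π(S₋S₀⁻¹S₋)`

HONEST FRAMING.  Cell `pub-symmetroid`, seat `val-sym-mdr-p2` (gen 21); helper file `--supports` the crux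
`Theses.LacunarySymmetroid.MatrixDescartes` (OPEN), NO closure claim; the `K = 3` instance of `…MonotoneExactPencil`
(`monotone_pencil_card_posRoots_multiset_eq_blockGram`) with the block Gram matrices REINDEXED to plain `m × m` matrices, so
the count is two inertia computations on `S₊S₀⁻¹S₊` and `S₋S₀⁻¹S₋`.  An EXACT COUNT on a three-letter monotone sector;
nothing here bears on the crux in its window, `stub_twoSided`, `DoorA26` / `DoorA34`, registers, or `VP ≠ VNP`.

* `negIndex_submatrix_equiv` / `posIndex_submatrix_equiv` — the indices are invariant under re-indexing by an equivalence
  (`A.submatrix e e`), Sylvester in family language.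
* **`threeLetters_card_posRoots_multiset_eq` (THE THREE-LETTER FORMULA).**  `S₋, S₀, S₊` real symmetric `m × m`,
  `det S₀ ≠ 0`, `S₊ ⪰ 0`, `−S₋ ⪰ 0`, exponents `a < b < c`: the positive zeros of `det(X^aS₋ + X^bS₀ + X^cS₊)` counted with
  multiplicity number exactly `ν(S₊S₀⁻¹S₊) + π(S₋S₀⁻¹S₋)` (`≤ ν(S₀) + π(S₀) = m`); `threeLetters_posRoots_eq_zero_iff`: no
  positive zero iff `ν(S₊S₀⁻¹S₊) = 0 ∧ π(S₋S₀⁻¹S₋) = 0`; `threeLetters_card_posRoots_multiset_le`: `Z₊ ≤ ν(S₀) + π(S₀) = m`.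
  Examples (paper): `S₀ ≻ 0` ⇒ `Z₊ = π(S₋S₀⁻¹S₋) = rank S₋` (`S₋S₀⁻¹S₋ ⪰ 0`); `S₀ ≺ 0` ⇒ `Z₊ = ν(S₊S₀⁻¹S₊) = rank S₊`; for
  indefinite `S₀` both blocks contribute.

[folklore] (Sylvester's law of inertia).  Axioms `propext`, `Classical.choice`, `Quot.sound`.  No definitions.
-/

-- layout Summits/ValiantsHypothesis/ValiantsHypothesis forces the duplicated namespace component
set_option linter.dupNamespace false

namespace Summit.ValiantsHypothesis.ValiantsHypothesis.Theorems.LacunarySymmetroidMatrixDescartes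

open Polynomial Matrix Finset
open scoped BigOperators

/-! ## §1  Re-indexing invariance of the indices -/

namespace Inertia

variable {κ κ' : Type} [Fintype κ] [DecidableEq κ] [Fintype κ'] [DecidableEq κ']

omit [DecidableEq κ] [DecidableEq κ'] in
/-- The form of a re-indexed matrix: `vᵀ (A∘(e,e)) v = (v∘e⁻¹)ᵀ A (v∘e⁻¹)`. [folklore] -/
theorem form_submatrix_equiv (A : Matrix κ κ ℝ) (e : κ' ≃ κ) (v : κ' → ℝ) :
    v ⬝ᵥ (A.submatrix e e *ᵥ v) = (v ∘ e.symm) ⬝ᵥ (A *ᵥ (v ∘ e.symm)) := by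
  rw [Matrix.submatrix_mulVec_equiv]
  exact (comp_equiv_symm_dotProduct v (A *ᵥ (v ∘ e.symm)) e).symm

/-- **`ν(A∘(e,e)) = ν(A)`** for an index equivalence `e`. [folklore] -/
theorem negIndex_submatrix_equiv {A : Matrix κ κ ℝ} (hA : A.IsHermitian) (e : κ' ≃ κ)
    (hA' : (A.submatrix e e).IsHermitian) :
    Fintype.card {j // hA'.eigenvalues j < 0} = Fintype.card {j // hA.eigenvalues j < 0} := by
  classical
  apply le_antisymm
  · refine card_le_negIndex hA (fun i : {j // hA'.eigenvalues j < 0} => (hA'.eigenvectorBasis i.1).ofLp ∘ e.symm)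
      fun c hc => ?_
    have h := neg_eigenFamily hA' c hc
    rw [form_submatrix_equiv] at h
    have hsum : (∑ i, c i • ((hA'.eigenvectorBasis i.1).ofLp ∘ e.symm))
        = (∑ i, c i • (hA'.eigenvectorBasis i.1).ofLp) ∘ e.symm := by
      funext s; simp only [Finset.sum_apply, Pi.smul_apply, Function.comp_apply]
    rw [hsum]
    exact h
  · refine card_le_negIndex hA' (fun i : {j // hA.eigenvalues j < 0} => (hA.eigenvectorBasis i.1).ofLp ∘ e)
      fun c hc => ?_
    have h := neg_eigenFamily hA c hc
    have hsum : (∑ i, c i • ((hA.eigenvectorBasis i.1).ofLp ∘ e))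
        = (∑ i, c i • (hA.eigenvectorBasis i.1).ofLp) ∘ e := by
      funext s; simp only [Finset.sum_apply, Pi.smul_apply, Function.comp_apply]
    rw [hsum, form_submatrix_equiv]
    have hee : ((∑ i, c i • (hA.eigenvectorBasis i.1).ofLp) ∘ ⇑e) ∘ ⇑e.symm
        = ∑ i, c i • ((hA.eigenvectorBasis i.1).ofLp : κ → ℝ) := by
      funext s; simp only [Function.comp_apply, Equiv.apply_symm_apply]
    rw [hee]
    exact h

/-- **`π(A∘(e,e)) = π(A)`** for an index equivalence `e`. [folklore] -/
theorem posIndex_submatrix_equiv {A : Matrix κ κ ℝ} (hA : A.IsHermitian) (e : κ' ≃ κ)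
    (hA' : (A.submatrix e e).IsHermitian) :
    Fintype.card {j // 0 < hA'.eigenvalues j} = Fintype.card {j // 0 < hA.eigenvalues j} := by
  have hnA : (-A).IsHermitian := hA.neg
  have hnA' : (-(A.submatrix e e)).IsHermitian := hA'.neg
  have hnAs : ((-A).submatrix e e).IsHermitian := hnA.submatrix _
  rw [← GramDual.negIndex_neg_eq_posIndex hA hnA, ← GramDual.negIndex_neg_eq_posIndex hA' hnA',
    negIndex_congr hnA' hnAs (by rw [Matrix.submatrix_neg]; rfl)]
  exact negIndex_submatrix_equiv hnA e hnAs

end Inertia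

/-! ## §2  The three-letter formula -/

namespace GramDual

variable {m : ℕ}

/-- Re-indexing a Gram matrix: `(WᵀAW)∘(f,f) = (W∘f)ᵀ A (W∘f)`. [folklore] -/
theorem gram_submatrix {ι π π' : Type} [Fintype ι] [Fintype π] (W : Matrix ι π ℝ) (A : Matrix ι ι ℝ) (f : π' → π) :
    (Wᵀ * A * W).submatrix f f = (W.submatrix id f)ᵀ * A * W.submatrix id f := by
  rw [Matrix.submatrix_mul _ _ f id f Function.bijective_id, Matrix.submatrix_mul _ _ f id id Function.bijective_id,
    Matrix.transpose_submatrix, Matrix.submatrix_id_id]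


/-- **THE THREE-LETTER FORMULA.**  `S₋, S₀, S₊` real symmetric, `det S₀ ≠ 0`, `S₊ ⪰ 0`, `−S₋ ⪰ 0`, `a < b < c`: the
positive zeros of `det(X^aS₋ + X^bS₀ + X^cS₊)` counted with multiplicity number exactly `ν(S₊S₀⁻¹S₊) + π(S₋S₀⁻¹S₋)`.
[folklore] -/
theorem threeLetters_card_posRoots_multiset_eq (a b c : ℕ) (hab : a < b) (hbc : b < c)
    (Sn S₀ Sp : Matrix (Fin m) (Fin m) ℝ) (hSn : Sn.IsSymm) (hS₀ : S₀.IsSymm) (hSp : Sp.IsSymm) (hS₀u : IsUnit S₀.det)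
    (hp : Sp.PosSemidef) (hn : (-Sn).PosSemidef) (hGp : (Sp * S₀⁻¹ * Sp).IsHermitian) (hGn : (Sn * S₀⁻¹ * Sn).IsHermitian) :
    Multiset.card ((Matrix.det (((Polynomial.X : Polynomial ℝ) ^ a) • Sn.map Polynomial.C
        + ((Polynomial.X : Polynomial ℝ) ^ b) • S₀.map Polynomial.C
        + ((Polynomial.X : Polynomial ℝ) ^ c) • Sp.map Polynomial.C)).roots.filter (fun t => 0 < t))
      = Fintype.card {j // hGp.eigenvalues j < 0} + Fintype.card {j // 0 < hGn.eigenvalues j} := by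
  classical
  -- the pencil data
  set d : Fin 3 → ℕ := ![a, b, c] with hd
  set S : Fin 3 → Matrix (Fin m) (Fin m) ℝ := ![Sn, S₀, Sp] with hSdef
  have hS : ∀ l, (S l).IsHermitian := by
    intro l
    fin_cases l
    · exact isHermitian_of_isSymm_real hSn
    · exact isHermitian_of_isSymm_real hS₀
    · exact isHermitian_of_isSymm_real hSp
  have hsum : (∑ l, ((Polynomial.X : Polynomial ℝ) ^ d l) • (S l).map Polynomial.C)
      = ((Polynomial.X : Polynomial ℝ) ^ a) • Sn.map Polynomial.C + ((Polynomial.X : Polynomial ℝ) ^ b) • S₀.map Polynomial.C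
        + ((Polynomial.X : Polynomial ℝ) ^ c) • Sp.map Polynomial.C := by
    rw [Fin.sum_univ_three]
    rfl
  have hS₀' : IsUnit (S 1).det := hS₀u
  have hmono : ∀ l : Fin 3, l ≠ 1 → ((S l).PosSemidef ∧ d 1 < d l) ∨ ((-(S l)).PosSemidef ∧ d l < d 1) := by
    intro l hl
    fin_cases l
    · exact Or.inr ⟨hn, hab⟩
    · exact absurd rfl hl
    · exact Or.inl ⟨hp, hbc⟩
  have hmain := monotone_pencil_card_posRoots_multiset_eq_blockGram d S hS 1 hS₀' hmono
  rw [hsum] at hmain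
  rw [hmain]
  -- which letters are upper / lower
  have hup : ∀ l : Fin 3, d 1 < d l → l = 2 := by
    intro l hl
    fin_cases l
    · exact absurd (lt_trans hab hl) (lt_irrefl _)
    · exact absurd hl (lt_irrefl _)
    · rfl
  have hlow : ∀ l : Fin 3, d l < d 1 → l = 0 := by
    intro l hl
    fin_cases l
    · rfl
    · exact absurd hl (lt_irrefl _)
    · exact absurd (lt_trans hbc hl) (lt_irrefl _)
  have h2 : d 1 < d 2 := hbc
  have h0 : d 0 < d 1 := hab
  -- equivalences `Fin m ≃ {l // d 1 < d l} × Fin m` and `Fin m ≃ {l // d l < d 1} × Fin m`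
  set eU : Fin m ≃ {l : Fin 3 // d 1 < d l} × Fin m :=
    { toFun := fun i => (⟨2, h2⟩, i)
      invFun := fun p => p.2
      left_inv := fun i => rfl
      right_inv := fun p => by
        rcases p with ⟨⟨l, hl⟩, i⟩
        have : l = 2 := hup l hl
        subst this
        rfl } with heU
  set eL : Fin m ≃ {l : Fin 3 // d l < d 1} × Fin m :=
    { toFun := fun i => (⟨0, h0⟩, i)
      invFun := fun p => p.2
      left_inv := fun i => rfl
      right_inv := fun p => by
        rcases p with ⟨⟨l, hl⟩, i⟩
        have : l = 0 := hlow l hl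
        subst this
        rfl } with heL
  have hWU : (Matrix.of fun (x : Fin m) (p : {l : Fin 3 // d 1 < d l} × Fin m) => S p.1.1 x p.2).submatrix id eU = Sp := by
    ext x i; rfl
  have hWL : (Matrix.of fun (x : Fin m) (p : {l : Fin 3 // d l < d 1} × Fin m) => S p.1.1 x p.2).submatrix id eL = Sn := by
    ext x i; rfl
  have hGU : (((Matrix.of fun (x : Fin m) (p : {l : Fin 3 // d 1 < d l} × Fin m) => S p.1.1 x p.2)ᵀ * (S 1)⁻¹
        * (Matrix.of fun (x : Fin m) (p : {l : Fin 3 // d 1 < d l} × Fin m) => S p.1.1 x p.2)).submatrix eU eU)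
      = Sp * S₀⁻¹ * Sp := by
    rw [gram_submatrix, hWU, hSp.eq]
    rfl
  have hGL : (((Matrix.of fun (x : Fin m) (p : {l : Fin 3 // d l < d 1} × Fin m) => S p.1.1 x p.2)ᵀ * (S 1)⁻¹
        * (Matrix.of fun (x : Fin m) (p : {l : Fin 3 // d l < d 1} × Fin m) => S p.1.1 x p.2)).submatrix eL eL)
      = Sn * S₀⁻¹ * Sn := by
    rw [gram_submatrix, hWL, hSn.eq]
    rfl
  have hA := isHermitian_upperBlockGram d S hS 1
  have hB := isHermitian_lowerBlockGram d S hS 1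
  have hA' := hA.submatrix eU
  have hB' := hB.submatrix eL
  rw [← Inertia.negIndex_submatrix_equiv hA eU hA', ← Inertia.posIndex_submatrix_equiv hB eL hB',
    Inertia.negIndex_congr hA' hGp hGU, Inertia.posIndex_congr hB' hGn hGL]

/-- **Three letters: sterile ⟺ `ν(S₊S₀⁻¹S₊) = 0 ∧ π(S₋S₀⁻¹S₋) = 0`.** [folklore] -/
theorem threeLetters_posRoots_eq_zero_iff (a b c : ℕ) (hab : a < b) (hbc : b < c)
    (Sn S₀ Sp : Matrix (Fin m) (Fin m) ℝ) (hSn : Sn.IsSymm) (hS₀ : S₀.IsSymm) (hSp : Sp.IsSymm) (hS₀u : IsUnit S₀.det)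
    (hp : Sp.PosSemidef) (hn : (-Sn).PosSemidef) (hGp : (Sp * S₀⁻¹ * Sp).IsHermitian) (hGn : (Sn * S₀⁻¹ * Sn).IsHermitian) :
    (Matrix.det (((Polynomial.X : Polynomial ℝ) ^ a) • Sn.map Polynomial.C
        + ((Polynomial.X : Polynomial ℝ) ^ b) • S₀.map Polynomial.C
        + ((Polynomial.X : Polynomial ℝ) ^ c) • Sp.map Polynomial.C)).roots.filter (fun t => 0 < t) = 0
      ↔ Fintype.card {j // hGp.eigenvalues j < 0} = 0 ∧ Fintype.card {j // 0 < hGn.eigenvalues j} = 0 := by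
  rw [← Multiset.card_eq_zero, threeLetters_card_posRoots_multiset_eq a b c hab hbc Sn S₀ Sp hSn hS₀ hSp hS₀u hp hn hGp hGn]
  omega

/-- **Three letters: `Z₊ ≤ ν(S₀) + π(S₀) = m` with multiplicity**, the budget split between the top and the bottom letter.
[folklore] -/
theorem threeLetters_card_posRoots_multiset_le (a b c : ℕ) (hab : a < b) (hbc : b < c)
    (Sn S₀ Sp : Matrix (Fin m) (Fin m) ℝ) (hSn : Sn.IsSymm) (hS₀ : S₀.IsSymm) (hSp : Sp.IsSymm) (hS₀u : IsUnit S₀.det)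
    (hp : Sp.PosSemidef) (hn : (-Sn).PosSemidef) (hS₀H : S₀.IsHermitian) :
    Multiset.card ((Matrix.det (((Polynomial.X : Polynomial ℝ) ^ a) • Sn.map Polynomial.C
        + ((Polynomial.X : Polynomial ℝ) ^ b) • S₀.map Polynomial.C
        + ((Polynomial.X : Polynomial ℝ) ^ c) • Sp.map Polynomial.C)).roots.filter (fun t => 0 < t))
      ≤ Fintype.card {j // hS₀H.eigenvalues j < 0} + Fintype.card {j // 0 < hS₀H.eigenvalues j} := by
  have hGp : (Sp * S₀⁻¹ * Sp).IsHermitian := by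
    have h := isHermitian_gram hS₀ Sp; rwa [hSp.eq] at h
  have hGn : (Sn * S₀⁻¹ * Sn).IsHermitian := by
    have h := isHermitian_gram hS₀ Sn; rwa [hSn.eq] at h
  rw [threeLetters_card_posRoots_multiset_eq a b c hab hbc Sn S₀ Sp hSn hS₀ hSp hS₀u hp hn hGp hGn]
  have h1 := negIndex_gram_le hS₀ hS₀u hS₀H Sp (isHermitian_gram hS₀ Sp)
  have h2 := posIndex_gram_le hS₀ hS₀u hS₀H Sn (isHermitian_gram hS₀ Sn)
  have e1 : Fintype.card {j // (isHermitian_gram hS₀ Sp).eigenvalues j < 0} = Fintype.card {j // hGp.eigenvalues j < 0} :=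
    Inertia.negIndex_congr _ hGp (by rw [hSp.eq])
  have e2 : Fintype.card {j // 0 < (isHermitian_gram hS₀ Sn).eigenvalues j} = Fintype.card {j // 0 < hGn.eigenvalues j} :=
    Inertia.posIndex_congr _ hGn (by rw [hSn.eq])
  omega

end GramDual

end Summit.ValiantsHypothesis.ValiantsHypothesis.Theorems.LacunarySymmetroidMatrixDescartes
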